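import Summits.ResolutionOfSingularities.ResolutionOfSingularities.Theorems.ShallowPort1

/-!
# ShallowPort2 — THE STEP of the in-field stalk chain (§5–§6)

* §5 `colon_span_pow_mul_eq_span` — colon against a power of the exceptional parameter.
* §6 `exists_extension_ker_eq_controlledTransform` — a stalk map `φ : 𝒪_{X,x} → L` killing exactly the principal marked stalk
  ideal extends along a point blowup `π : X' → X` (both regular) to `φ' : 𝒪_{X',x'} → L` killing exactly the stalk of the
  CONTROLLED transform, `φ'(𝒪_{X',x'})` dominating `φ(𝒪_{X,x})` and CERTIFIED (`PointBlowupCert`) to be its point blowup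
  (tree `IsBlowup.exists_reesChart_stalk`, `IsBlowup.exists_stalkIdeal_map_eq_span_pow_mul`, `chartToField`).

References: Herrmann–Ikeda–Orbanz (30.2); CP 2019 Def. 2.3 [CossartPiltant2019]. AI-written; weaker than expert review.
(decomp-res lens-5 g38, critic ROW 232 (M-Shallow); host route `MaxContactCut`, item stmt-ResolutionOfSingularities-31768 `PolyPureTowersShallow`;
source of truth: the farm-checked monolith `ShallowPortNode.lean`, of which this is land slice 2/6 — slices land sequentially, slice k imports slice k-1.)
-/

noncomputable section

set_option linter.dupNamespace false

open IsLocalRing IsLocalization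
open Literature.RingTheory.HilbertSamuel Literature.AlgebraicGeometry.Resolution
open Summit.ResolutionOfSingularities.ResolutionOfSingularities.Theorems.SigmaMaxModificationsCorridor3.Helpers
open Summit.ResolutionOfSingularities.ResolutionOfSingularities.Theorems.SwitchingDichotomy.SteeredRun

universe u

namespace Summit.ResolutionOfSingularities.ResolutionOfSingularities.Theorems.ShallowPort

/-! ## §5 Colon against a power of the exceptional parameter -/

section Colon

variable {S : Type u} [CommRing S] [IsDomain S]

/-- `((e^μ g) : (e)^μ) = (g)` for `e ≠ 0` in a domain. [cite: Kollar2007, 3.58–3.60] -/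
theorem colon_span_pow_mul_eq_span {e : S} (he0 : e ≠ 0) (g : S) (μ : ℕ) :
    Submodule.colon (Ideal.span {e ^ μ * g}) ((Ideal.span {e} ^ μ : Ideal S) : Set S) = Ideal.span {g} := by
  apply le_antisymm
  · intro z hz
    rw [Submodule.mem_colon] at hz
    have h1 : z • e ^ μ ∈ Ideal.span {e ^ μ * g} :=
      hz (e ^ μ) (by rw [SetLike.mem_coe, Ideal.span_singleton_pow]; exact Ideal.mem_span_singleton_self _)
    obtain ⟨t, ht⟩ := Ideal.mem_span_singleton'.mp h1
    refine Ideal.mem_span_singleton'.mpr ⟨t, ?_⟩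
    have h2 : e ^ μ * (t * g) = e ^ μ * z := by
      calc e ^ μ * (t * g) = t * (e ^ μ * g) := by ring
        _ = z • e ^ μ := ht
        _ = e ^ μ * z := by rw [smul_eq_mul, mul_comm]
    exact mul_left_cancel₀ (pow_ne_zero μ he0) h2
  · rw [Ideal.span_le, Set.singleton_subset_iff, SetLike.mem_coe, Submodule.mem_colon]
    intro s hs
    rw [SetLike.mem_coe, Ideal.span_singleton_pow] at hs
    obtain ⟨a, rfl⟩ := Ideal.mem_span_singleton'.mp hs
    exact Ideal.mem_span_singleton'.mpr ⟨a, by rw [smul_eq_mul]; ring⟩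

end Colon

/-! ## §6 THE STEP: transporting the in-field presentation of a hypersurface germ through a point blow-up -/

section Step

open CategoryTheory AlgebraicGeometry TopologicalSpace
open Scheme.IdealSheafData

variable {X X' : Scheme.{0}} {π : X' ⟶ X}

set_option maxHeartbeats 4000000 in
/-- **The step of the stalk chain.**  Let `π : X' → X` be the blowing up of the regular locally Noetherian `X` at a
closed point `x = π(x')` (`X'` regular), `J` an ideal sheaf with `J_x = (h)` principal of order `μ ≥ 1` at `x`, and
`x'` a point of the weak transform `J' = (J𝒪_{X'} : 𝓘_E^μ)` (`J'_{x'} ⊆ 𝔪_{x'}`).  Let `φ : 𝒪_{X,x} → L` be a ring map to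
a field with kernel exactly `J_x`.  Then `φ` extends along `π^#_{x'}` to `φ' : 𝒪_{X',x'} → L` with kernel exactly
`J'_{x'}` (again principal), and `φ'(𝒪_{X',x'}) ⊆ L` is CERTIFIED (`PointBlowupCert`) to be the blowing up of the closed
point of `φ(𝒪_{X,x})` in the chart of a regular parameter.  Mechanism: `𝒪_{X',x'}` is a localization of a Rees chart
`𝒪_{X,x}[𝔪/c_j]` (`IsBlowup.exists_reesChart_stalk`), on which `φ` induces `θ₁` (`chartToField`); `J_x𝒪_{X',x'} = (e^μ g')`
with `e` the exceptional parameter, prime to `g'` (`IsBlowup.exists_stalkIdeal_map_eq_span_pow_mul`), and cancellation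
against `e` identifies `ker θ₁ · 𝒪_{X',x'}` with `(g') = J'_{x'}`.
[cite: HerrmannIkedaOrbanz1988, Thm. (30.2) (proof)] [cite: Kollar2007, 3.58–3.60] [cite: CossartPiltant2019, §2.2] -/
theorem exists_extension_ker_eq_controlledTransform
    [IsLocallyNoetherian X] [IsLocallyNoetherian X'] (hX : Scheme.IsRegular X) (hX' : Scheme.IsRegular X')
    {x' : X'} (hcl : IsClosed ({π.base x'} : Set X))
    (hreg : Scheme.IsRegular (vanishingIdeal (⟨{π.base x'}, hcl⟩ : Closeds X)).subscheme)
    (hπ : IsBlowup π (vanishingIdeal (⟨{π.base x'}, hcl⟩ : Closeds X)))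
    (J : X.IdealSheafData) {μ : ℕ} (hμ1 : 1 ≤ μ) (hord : idealOrder J (π.base x') = μ)
    (hJ : (stalkIdeal J (π.base x')).IsPrincipal)
    (hx' : stalkIdeal (controlledTransform π (vanishingIdeal (⟨{π.base x'}, hcl⟩ : Closeds X)) J μ) x' ≤
      maximalIdeal (X'.presheaf.stalk x'))
    {L : Type} [Field L] (φ : X.presheaf.stalk (π.base x') →+* L)
    (hker : RingHom.ker φ = stalkIdeal J (π.base x')) :
    ∃ φ' : X'.presheaf.stalk x' →+* L,
      RingHom.ker φ' = stalkIdeal (controlledTransform π (vanishingIdeal (⟨{π.base x'}, hcl⟩ : Closeds X)) J μ) x' ∧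
      (stalkIdeal (controlledTransform π (vanishingIdeal (⟨{π.base x'}, hcl⟩ : Closeds X)) J μ) x').IsPrincipal ∧
      (∀ a, φ' ((π.stalkMap x').hom a) = φ a) ∧
      Nonempty (PointBlowupCert φ.range φ'.range ((maximalIdeal (X.presheaf.stalk (π.base x'))).map φ.rangeRestrict)) := by
  classical
  haveI hA : IsRegularLocalRing (X.presheaf.stalk (π.base x')) := hX _
  haveI hO : IsRegularLocalRing (X'.presheaf.stalk x') := hX' _
  haveI : IsDomain (X'.presheaf.stalk x') := isDomain_of_isRegularLocalRing _
  -- generators `c` of `𝔪_x`, a Rees chart `χ : 𝒪_{X,x}[𝔪/c_j] → 𝒪_{X',x'}` presenting the stalk as a localization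
  obtain ⟨r, c, hc𝔪⟩ := Submodule.fg_iff_exists_fin_generating_family.mp
    (IsNoetherian.noetherian (maximalIdeal (X.presheaf.stalk (π.base x'))))
  have hc𝔪' : Ideal.span (Set.range c) = maximalIdeal (X.presheaf.stalk (π.base x')) := hc𝔪
  have hcY : Ideal.span (Set.range c) =
      stalkIdeal (vanishingIdeal (⟨{π.base x'}, hcl⟩ : Closeds X)) (π.base x') := by
    rw [stalkIdeal_vanishingIdeal_singleton]; exact hc𝔪'
  obtain ⟨j, 𝔴, χ, hχ, hloc, -⟩ := hπ.exists_reesChart_stalk x' c hcY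
  letI : Algebra (chartRing c j) (X'.presheaf.stalk x') := χ.toAlgebra
  haveI : IsLocalization.AtPrime (X'.presheaf.stalk x') 𝔴.asIdeal := hloc
  have hχ' : ∀ b, algebraMap (chartRing c j) (X'.presheaf.stalk x') b = χ b := fun b =>
    RingHom.congr_fun (RingHom.algebraMap_toAlgebra χ) b
  -- the total transform `J_x 𝒪_{X',x'} = (e^μ g')`
  have hY : ∀ y ∈ ((⟨{π.base x'}, hcl⟩ : Closeds X) : Set X), idealOrder J y = μ := by
    intro y hy
    obtain rfl : y = π.base x' := hy
    exact hord
  have hxY : π.base x' ∈ ((⟨{π.base x'}, hcl⟩ : Closeds X) : Set X) := Set.mem_singleton _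
  obtain ⟨e, g', hE, hmap, henzd, heprime, hg'e⟩ := hπ.exists_stalkIdeal_map_eq_span_pow_mul hX hreg hY hxY hJ
  have he0 : e ≠ 0 := nonZeroDivisors.ne_zero henzd
  -- the weak transform `J'_{x'} = (g')`, so `g' ∈ 𝔪_{x'}`
  have hctrl : stalkIdeal (controlledTransform π (vanishingIdeal (⟨{π.base x'}, hcl⟩ : Closeds X)) J μ) x' =
      Ideal.span {g'} := by
    rw [controlledTransform, stalkIdeal_colon, stalkIdeal_pow, stalkIdeal_comap_eq_map_stalkMap π J, hmap, hE]
    exact colon_span_pow_mul_eq_span he0 g' μ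
  have hg'𝔪 : g' ∈ maximalIdeal (X'.presheaf.stalk x') := hx' (hctrl ▸ Ideal.mem_span_singleton_self g')
  -- the exceptional parameter: `(e) = 𝔪_x 𝒪_{X',x'} = (c_j)` in the `c_j`-chart, so `c_j = u e` with `u` a unit
  have hcl' : ∀ l, (π.stalkMap x').hom (c l) = (π.stalkMap x').hom (c j) * χ (chartGen c j l) := by
    intro l
    rw [← hχ, ← hχ, ← RingHom.map_mul, ← reesChartBase_apply_eq_mul_chartGen c j l]
  have hEc : Ideal.span {e} = Ideal.span {(π.stalkMap x').hom (c j)} := by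
    rw [← hE, stalkIdeal_comap_eq_map_stalkMap π, ← hcY, Ideal.map_span]
    apply le_antisymm
    · apply Ideal.span_le.mpr
      rintro _ ⟨_, ⟨l, rfl⟩, rfl⟩
      rw [SetLike.mem_coe, hcl' l]
      exact Ideal.mul_mem_right _ _ (Ideal.mem_span_singleton_self _)
    · apply Ideal.span_le.mpr
      rintro _ ⟨⟩
      exact Ideal.subset_span ⟨c j, ⟨j, rfl⟩, rfl⟩
  obtain ⟨u, hunit, hu⟩ : ∃ u, IsUnit u ∧ (π.stalkMap x').hom (c j) = u * e := by
    have h1 : (π.stalkMap x').hom (c j) ∈ Ideal.span {e} := hEc ▸ Ideal.mem_span_singleton_self _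
    have h2 : e ∈ Ideal.span {(π.stalkMap x').hom (c j)} := hEc ▸ Ideal.mem_span_singleton_self _
    obtain ⟨a, ha⟩ := Ideal.mem_span_singleton'.mp h1
    obtain ⟨b, hb⟩ := Ideal.mem_span_singleton'.mp h2
    refine ⟨a, ?_, ha.symm⟩
    have h3 : (b * a - 1) * e = 0 := by rw [sub_mul, mul_assoc, ha, hb, one_mul, sub_self]
    have hba : b * a = 1 := sub_eq_zero.mp ((mul_eq_zero.mp h3).resolve_right he0)
    exact IsUnit.of_mul_eq_one b (by rw [mul_comm]; exact hba)
  -- `φ(c_j) ≠ 0`: otherwise `c_j ∈ J_x`, `u e ∈ (e^μ g')` and `u ∈ (g') ⊆ 𝔪`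
  obtain ⟨μ', rfl⟩ : ∃ μ', μ = μ' + 1 := ⟨μ - 1, by omega⟩
  have hφcj : φ (c j) ≠ 0 := by
    intro h0
    have hmem : c j ∈ stalkIdeal J (π.base x') := by
      rw [← hker]
      exact RingHom.mem_ker.mpr h0
    have h1 : (π.stalkMap x').hom (c j) ∈ Ideal.span {e ^ (μ' + 1) * g'} := hmap ▸ Ideal.mem_map_of_mem _ hmem
    obtain ⟨t, ht⟩ := Ideal.mem_span_singleton'.mp h1
    have h2 : (u - t * e ^ μ' * g') * e = 0 := by
      have h3 : u * e = t * (e ^ (μ' + 1) * g') := by rw [← hu, ht]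
      calc (u - t * e ^ μ' * g') * e = u * e - t * (e ^ (μ' + 1) * g') := by ring
        _ = 0 := by rw [h3, sub_self]
    have h3 : u = t * e ^ μ' * g' := sub_eq_zero.mp ((mul_eq_zero.mp h2).resolve_right he0)
    have h4 : u ∈ maximalIdeal (X'.presheaf.stalk x') := h3 ▸ Ideal.mul_mem_left _ _ hg'𝔪
    exact (IsLocalRing.mem_maximalIdeal _).mp h4 hunit
  -- a generator `h` of `J_x`; `φ h = 0`
  obtain ⟨h, hh⟩ := (Submodule.isPrincipal_iff _).mp hJ
  have hh' : stalkIdeal J (π.base x') = Ideal.span {h} := hh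
  have hφh : φ h = 0 := by
    have hmem : h ∈ stalkIdeal J (π.base x') := hh' ▸ Ideal.mem_span_singleton_self h
    rw [← hker] at hmem
    exact RingHom.mem_ker.mp hmem
  -- KEY: an element of the chart killed by `θ₁ = chartToField c j φ` maps into `(g')` in the stalk
  have key : ∀ b : chartRing c j, chartToField c j φ hφcj b = 0 → χ b ∈ Ideal.span {g'} := by
    intro b hb
    obtain ⟨k, s, hks⟩ := exists_pow_mul_eq_reesChartBase c j b
    have hφs : φ s = 0 := by
      by_contra hne
      exact ((chartToField_ne_zero_iff c j φ hφcj hks).mpr hne) hb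
    have hs : s ∈ RingHom.ker φ := RingHom.mem_ker.mpr hφs
    rw [hker, hh'] at hs
    obtain ⟨t, rfl⟩ := Ideal.mem_span_singleton'.mp hs
    have hsMh : (π.stalkMap x').hom h ∈ Ideal.span {e ^ (μ' + 1) * g'} :=
      hmap ▸ Ideal.mem_map_of_mem _ (hh' ▸ Ideal.mem_span_singleton_self h)
    obtain ⟨v, hv⟩ := Ideal.mem_span_singleton'.mp hsMh
    have h1 : (π.stalkMap x').hom (c j) ^ k * χ b = (π.stalkMap x').hom t * (π.stalkMap x').hom h := by
      have h2 := congrArg χ hks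
      rw [RingHom.map_mul, RingHom.map_pow, hχ, hχ, RingHom.map_mul] at h2
      exact h2
    rw [hu, ← hv, mul_pow] at h1
    have h2 : e ^ k * (u ^ k * χ b) = e ^ (μ' + 1) * g' * ((π.stalkMap x').hom t * v) := by
      calc e ^ k * (u ^ k * χ b) = u ^ k * e ^ k * χ b := by ring
        _ = (π.stalkMap x').hom t * (v * (e ^ (μ' + 1) * g')) := h1
        _ = e ^ (μ' + 1) * g' * ((π.stalkMap x').hom t * v) := by ring
    have h3 : u ^ k * χ b ∈ Ideal.span {g'} := mem_span_singleton_of_pow_mul_eq he0 heprime hg'e h2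
    obtain ⟨w, hw⟩ := Ideal.mem_span_singleton'.mp h3
    obtain ⟨uk, huk⟩ := hunit.pow k
    refine Ideal.mem_span_singleton'.mpr ⟨↑uk⁻¹ * w, ?_⟩
    rw [mul_assoc, hw, ← huk, ← mul_assoc, Units.inv_mul, one_mul]
  -- hence `ker θ₁ ⊆ 𝔴`, and `θ₁` extends to the localization `𝒪_{X',x'}`
  have hkerw : ∀ b : chartRing c j, chartToField c j φ hφcj b = 0 → b ∈ 𝔴.asIdeal := by
    intro b hb
    have h1 : χ b ∈ maximalIdeal (X'.presheaf.stalk x') :=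
      (Ideal.span_le.mpr (Set.singleton_subset_iff.mpr hg'𝔪)) (key b hb)
    exact (IsLocalization.AtPrime.to_map_mem_maximal_iff (X'.presheaf.stalk x') 𝔴.asIdeal b).mp h1
  have hunits : ∀ s : 𝔴.asIdeal.primeCompl, IsUnit (chartToField c j φ hφcj s) := fun s =>
    isUnit_iff_ne_zero.mpr fun h0 => s.2 (hkerw s h0)
  refine ⟨IsLocalization.lift (M := 𝔴.asIdeal.primeCompl) hunits, ?_⟩
  have hφ'χ : ∀ b, IsLocalization.lift (M := 𝔴.asIdeal.primeCompl) hunits (χ b) = chartToField c j φ hφcj b :=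
    fun b => by rw [← hχ' b, IsLocalization.lift_eq]
  have hcomp : ∀ a, IsLocalization.lift (M := 𝔴.asIdeal.primeCompl) hunits ((π.stalkMap x').hom a) = φ a :=
    fun a => by rw [← hχ, hφ'χ, chartToField_reesChartBase]
  -- `φ'(e) ≠ 0` and `φ'(g') = 0`
  have hφ'e : IsLocalization.lift (M := 𝔴.asIdeal.primeCompl) hunits e ≠ 0 := by
    intro h0
    apply hφcj
    rw [← hcomp, hu, map_mul, h0, mul_zero]
  have hφ'g : IsLocalization.lift (M := 𝔴.asIdeal.primeCompl) hunits g' = 0 := by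
    have h1 : Ideal.span {(π.stalkMap x').hom h} = Ideal.span {e ^ (μ' + 1) * g'} := by
      rw [← hmap, hh', Ideal.map_span, Set.image_singleton]
    have h2 : e ^ (μ' + 1) * g' ∈ Ideal.span {(π.stalkMap x').hom h} := h1 ▸ Ideal.mem_span_singleton_self _
    obtain ⟨v', hv'⟩ := Ideal.mem_span_singleton'.mp h2
    have h3 : IsLocalization.lift (M := 𝔴.asIdeal.primeCompl) hunits (e ^ (μ' + 1) * g') = 0 := by
      rw [← hv', map_mul, hcomp, hφh, mul_zero]
    rw [map_mul, map_pow] at h3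
    exact (mul_eq_zero.mp h3).resolve_left (pow_ne_zero _ hφ'e)
  -- the kernel of `φ'` is `(g')`
  have hker' : RingHom.ker (IsLocalization.lift (M := 𝔴.asIdeal.primeCompl) hunits) = Ideal.span {g'} := by
    apply le_antisymm
    · intro z hz
      obtain ⟨⟨b, s⟩, rfl⟩ := IsLocalization.mk'_surjective 𝔴.asIdeal.primeCompl z
      change IsLocalization.mk' (X'.presheaf.stalk x') b s ∈
        RingHom.ker (IsLocalization.lift (M := 𝔴.asIdeal.primeCompl) hunits) at hz
      change IsLocalization.mk' (X'.presheaf.stalk x') b s ∈ Ideal.span {g'}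
      have hzs : IsLocalization.lift (M := 𝔴.asIdeal.primeCompl) hunits
            (IsLocalization.mk' (X'.presheaf.stalk x') b s) * chartToField c j φ hφcj s =
          chartToField c j φ hφcj b := by
        rw [← hφ'χ s, ← hφ'χ b, ← RingHom.map_mul, ← hχ' (s : chartRing c j), IsLocalization.mk'_spec, hχ']
      rw [RingHom.mem_ker] at hz
      rw [hz, zero_mul] at hzs
      rw [IsLocalization.mk'_eq_mul_mk'_one, hχ']
      exact Ideal.mul_mem_right _ _ (key b hzs.symm)
    · rw [Ideal.span_le, Set.singleton_subset_iff]
      exact hφ'g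
  -- the chart closure contains `θ₁` of everything
  have hsub : Subring.closure (Set.range φ ∪ Set.range fun l => φ (c l) / φ (c j)) ≤
      chartClosure φ.range (fun l => φ.rangeRestrict (c l)) j := by
    rw [Subring.closure_le]
    rintro z (⟨a, rfl⟩ | ⟨l, rfl⟩)
    · exact Subring.subset_closure (Or.inl ⟨a, rfl⟩)
    · exact Subring.subset_closure (Or.inr ⟨φ.rangeRestrict (c l), ⟨l, rfl⟩, rfl⟩)
  have hθcl : ∀ b, chartToField c j φ hφcj b ∈ chartClosure φ.range (fun l => φ.rangeRestrict (c l)) j :=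
    fun b => hsub (by rw [← range_chartToField c j φ hφcj]; exact ⟨b, rfl⟩)
  refine ⟨hctrl ▸ hker', hctrl ▸ ⟨⟨g', rfl⟩⟩, hcomp, ⟨⟨r, fun l => φ.rangeRestrict (c l), j, ?_, ?_, ?_, ?_⟩⟩⟩
  · -- `(φ c) = 𝔪_x φ(𝒪_{X,x})`
    rw [← hc𝔪', Ideal.map_span, ← Set.range_comp]
    rfl
  · intro h0
    exact hφcj (by simpa using congrArg Subtype.val h0)
  · rw [chartClosure, Subring.closure_le]
    rintro z (hz | ⟨y, ⟨l, rfl⟩, rfl⟩)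
    · obtain ⟨a, rfl⟩ := (RingHom.mem_range.mp hz)
      exact ⟨(π.stalkMap x').hom a, hcomp a⟩
    · exact ⟨χ (chartGen c j l), by rw [hφ'χ, chartToField_chartGen]; rfl⟩
  · rintro _ ⟨z, rfl⟩
    obtain ⟨⟨b, s⟩, rfl⟩ := IsLocalization.mk'_surjective 𝔴.asIdeal.primeCompl z
    change ∃ y ∈ _, ∃ z ∈ _, z ≠ 0 ∧ z⁻¹ ∈ _ ∧
      IsLocalization.lift (M := 𝔴.asIdeal.primeCompl) hunits (IsLocalization.mk' (X'.presheaf.stalk x') b s) = y / z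
    have hs0 : chartToField c j φ hφcj s ≠ 0 := (hunits s).ne_zero
    refine ⟨chartToField c j φ hφcj b, hθcl b, chartToField c j φ hφcj s, hθcl s, hs0, ?_, ?_⟩
    · refine ⟨IsLocalization.mk' (X'.presheaf.stalk x') 1 s, eq_inv_of_mul_eq_one_left ?_⟩
      rw [← hφ'χ s, ← hχ' (s : chartRing c j), ← RingHom.map_mul, IsLocalization.mk'_spec, hχ', hφ'χ,
        map_one]
    · have h1 : IsLocalization.lift (M := 𝔴.asIdeal.primeCompl) hunits
            (IsLocalization.mk' (X'.presheaf.stalk x') b s) * chartToField c j φ hφcj s =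
          chartToField c j φ hφcj b := by
        rw [← hφ'χ s, ← hφ'χ b, ← RingHom.map_mul, ← hχ' (s : chartRing c j), IsLocalization.mk'_spec, hχ']
      rw [eq_div_iff hs0]
      exact h1

end Step

end Summit.ResolutionOfSingularities.ResolutionOfSingularities.Theorems.ShallowPort
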